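import Summits.QuantumFields.YangMills.Theorems.BalabanUVNodesN15KingModelPerturbedLeaves
import Summits.QuantumFields.YangMills.Theorems.BalabanUVNodesN15KingModelContinuum

/-!
# Route «BalabanUVNodes» (K4 «SpineRates»), node N15 = NE2 — THE KING-MODEL RUNG, part 6b: KING'S UNIT-LATTICE COVARIANCE WITH THE BACKGROUND
# BLOCK LIVE — the dressed tower `Δ^{(k)} + E_k`, (3.35) ∧ (3.36) CONSUMED as the locality ∕ two-spacing letters of the background, `NE2PlusUnit` BY
# NAME with a configuration-dependent kernel, and background-Lipschitz continuity in position space uniformly in the level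

Cell `pub-ymgap`, Track A (D-0062), seat `pub-ymgap-dag-n15-d` (R134 seat, strategy s3 «King 1986 Lemma 4.5 (4.38) as the scalar kernel», gen 4;
dag-lead FAN-OUT v1.2 §N15 s3 «KING-MODEL RUNG»).  `bears_on: R4∕N15`; `--supports` the K3′ item `SpineGivenEndpointR12` (stmt-QuantumFields-19908,
rev 15).  COUNT-NEUTRAL; definition lane (one background sort, one pairing, one instance family, the dressed covariance ∕ kernel ∕ distance and three
constants are data; every theorem is by-name plumbing of LANDED kernel theorems: part 3 `…KingModelLeaves`, part 5 `…KingModelContinuum`, part 6a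
`…KingModelPerturbedLeaves`).

WHY THIS FILE.  In the lineage's five parts the background carrier of the King family is the ONE-POINT sort `pt9Bg` — (3.35)∕(3.36) idle, NOT why the
layers hold (said in every HONEST SCOPE); the node's OPERATOR layer meanwhile has producers with the background block LIVE (n15-b A1–A4, n15-c C∕G∕V
series), and n15-c's closers `…N15AtSpineCarriersBackground`∕`…GaugeMatrix` DISPLAY the site and unit layers because «no producer with the background
live exists in the tree» for them.  THIS FILE is the unit layer's producer with the background block LIVE in the King model world, on the SAME
mechanism as the printed `A = 0` proof:
§1 the background sort `kingBg`: configurations = towers `E = (E_j)_j` of perturbations of King's effective Laplacians on the unit lattice (trivial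
background = `0`, composition = `+`), **(3.35) at `(c₃₅, α₀)` := the locality letter `UniformKernelDecay E |·|_T (c₃₅α₀) κ′`** (K-uniform decay at
King's doubled Combes–Thomas rate), **(3.36) at `(c₃₅, α₀)` := the two-spacing letter `EffectiveOperatorSupRate E (c₃₅α₀) L⁻²`**; the pairing
`kingPairingE` (identity, `avg = id`) and the DRESSED FAMILY `kingInstanceE` (part 1's realised geometries, `kingBg` live on both sides).
§2 the dressed covariance `kingCovE E j = (Δ^{(max j 1)} + E_j + aL⁻²Q*Q)⁻¹` (`kingCovE_zero`), the size threshold `c̄ = kingCbar = γ₀∕(8V)`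
(`kingGap`: `ρ + ρ_B + 2c_E V < γ₀` for `c_E ≤ c̄`; `kingMargin`: margin `≥ γ₀∕4`), the constants `Λ_K = kingLip = (4∕γ₀)²V²`, `C_K^E = kingCE`.
§3 **`kingLeavesE`** — the five leaves of `Δ + E` at every local background with a one-step rate (part 3's leaves + 6a's `perturbedLeaves`);
**`covarianceTowerRate_kingTowerE`** — (4.38) WITH THE BACKGROUND LIVE at every level, SAME decay `δ₄₅` and rate `L⁻¹` as the undressed
`covarianceTowerRate_kingTower`, constant `C_K^E` UNIFORM over the backgrounds of size `≤ c̄`; **`kingCovE_lipschitz`** —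
`|(Δ^{(j)} + aL⁻²Q*Q)⁻¹(x,y) − C_E^{(j)}(x,y)| ≤ c_E·Λ_K·e^{−δ₄₅|x−y|_T}` at EVERY level: LINEAR in the background size, with decay (6a's
`inv_sub_inv_perturbed_le` = `King1986.lemma45` at one level).
§4 the dressed unit kernel `kingKerE` (`(E, y, y′) ↦ C_E^{(k+1)}(y,y′) − C_E^{(k)}(y,y′)`, GENUINELY configuration-dependent; `kingKerE_zero`: at the trivial
background it IS part 3's `kingKer1`), and **`ne2PlusUnit_kingE`**: `NE2PlusUnit c35 (kingInstanceE a) (kingKerE a m²) ⊤ tdistT` for EVERY `c₃₅ > 0` —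
the socket's window `a₀ = c̄∕c₃₅` makes `Msz·α₀ ≤ a₀ ⇒ c₃₅α₀ ≤ c̄`, (3.35) SUPPLIES the locality letter and (3.36) the two-spacing letter at that size,
and 6a's `ne2PlusUnit_of_freeLeaves_add` fires on part 3's free leaves: BOTH REGULARITY CONDITIONS CONSUMED, all five leaves LIVE at every regular
background, constants uniform in the index AND the background; `ne2ZeroUnit_kingE`.
§5 → part 6c `…KingModelPerturbedLimit` (the continuum limit `C_E^{(∞)}` with the background live, its Lipschitz dependence, the `LocalRate` currency).

HONEST FRAMING ∕ LIMITS.  King's `A = 0` SCALAR tower (periodic b.c., flat blocks, `m² > 0`, `L ≥ 2`, levels `k ≥ 1`) DRESSED BY AN ABSTRACT LOCAL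
PERTURBATION TOWER: the background sort is NOT Bałaban's gauge-field configurations and the letters are a READING of the (3.35)∕(3.36) slots as
locality ∕ two-spacing bounds of the perturbation — for Bałaban's `E_k(U) = Δ^{(k)}(U) − Δ^{(k)}(1)` these are the Spine's (H-bd)∕(H-cons) in position
space, NOT PRINTED ([B9] prints η-uniformity, never an η-difference; King prints (4.38) at `A = 0` only, p. 670), asserted by nobody; no symmetry of `E`
is assumed or used (coercivity is of the quadratic form); NOT Bałaban's `C^{(k)}(Λ; U)`, `G(U)`, `ℋ(U)`; NOT the carriers of record (NODE 00); the
operator ∕ site layers are untouched (parts 1–2, n15-e); NOT a node discharge; typed 28∕28, discharged count untouched; one finite torus programme at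
fixed ε — NOT ℝ⁴ ∕ infinite volume ∕ OS ∕ mass gap ∕ Clay.  Locators only: [King1986] CMP **102** (1986) Lemma 4.3 (4.18) p. 672, (4.32)–(4.34), (4.38)
p. 674, (4.39)–(4.41) p. 675, pp. 664, 670; [B9] = [Balaban1985BackgroundPropagators] CMP **99** (1985) (3.35)–(3.36) p. 396, Thm 3.14–3.15 pp. 426–432.
-/

noncomputable section

open scoped BigOperators Matrix
open Finset Filter Topology

namespace Summit.QuantumFields.YangMills.BalabanUVNodes.N15.KingModel

open Literature.MathematicalPhysics.QuantumFieldTheory.Balaban1983to89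
open Literature.MathematicalPhysics.QuantumFieldTheory.Balaban1983to89.QGQInverse (Coercive)
open Literature.MathematicalPhysics.QuantumFieldTheory.Balaban1983to89.B5Prop11Plancherel (Tor fine)
open Literature.MathematicalPhysics.QuantumFieldTheory.Balaban1983to89.T4EtaRate (PairedInstance EtaPairing NE2PlusUnit)
open Literature.MathematicalPhysics.QuantumFieldTheory.Balaban1983to89.T4EtaRateUnitWitness (NE2ZeroUnit ne2ZeroUnit_of_ne2PlusUnit)
open Literature.MathematicalPhysics.QuantumFieldTheory.King1986.Torus (tdistT tdistT_isPseudoDist aminL aminL_pos CDelU CDelU_pos gam0L gam0L_pos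
  kapCT kapCT_pos_le V45 thetaBar delta45)
open Summit.QuantumFields.BalabanUV.T4Continuum.NE2KingTransplant (IsPseudoMetric UniformCoercive UniformCTBound UniformKernelDecay
  EffectiveOperatorSupRate VolumeSum CovarianceTowerRate covarianceTowerRate_of_leaves)

variable {d : ℕ} {L : ℕ} [NeZero L]

/-! ## §1 The background sort with the block LIVE: local perturbation towers on King's unit lattice; (3.35)∕(3.36) as locality ∕ two-spacing letters -/

/-- **THE BACKGROUND SORT OF THE DRESSED KING FAMILY.**  Configurations = towers `E = (E_j)_j` of perturbations of King's effective Laplacians on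
the unit lattice `Π_μ ℤ∕K_μ` (level `j` of a background enters level `j` of the tower); trivial background = the zero tower; composition = addition;
**(3.35) at `(c₃₅, α₀)` := the LOCALITY letter** `|E_j(z, w)| ≤ c₃₅α₀·e^{−2κ|z−w|_T}` at every level (the socket's (H2′) for `E`);
**(3.36) at `(c₃₅, α₀)` := the TWO-SPACING letter** `|E_{j+1}(z, w) − E_j(z, w)| ≤ c₃₅α₀·r^j` (the socket's (H3) for `E`); the complex-extension
sorts (3.37)∕(3.38) inert.  `κ`, `r` are parameters (at the instance: King's Combes–Thomas rate `κ′` and ratio `L⁻²`).  HONEST SCOPE: an ABSTRACT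
perturbation sort — for Bałaban's `E_j(U) = Δ^{(j)}(U) − Δ^{(j)}(1)` these two letters are NOT PRINTED (b2b's (H-bd)∕(H-cons) in position space).
[cite: Balaban1985BackgroundPropagators, (3.35)–(3.36) p.396 (the two regularity slots: typing template)] -/
@[reducible] def kingBg (κ r : ℝ) (K : Fin (d + 1) → ℕ) [∀ μ, NeZero (K μ)] : B9.Backgrounds where
  Cfg := ℕ → Matrix (Tor K) (Tor K) ℝ
  one := 0
  mul := fun E E' => E + E'
  Reg335 := fun c35 α₀ E => UniformKernelDecay E (tdistT K) (c35 * α₀) κ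
  Reg336 := fun c35 α₀ E => EffectiveOperatorSupRate E (c35 * α₀) r
  Cplx337 := fun _ _ _ => True
  Cplx338 := fun _ _ _ => True

/-- **THE BACKGROUND SORT IS POPULATED BEYOND THE TRIVIAL TOWER**: the constant diagonal (mass-shift) tower `E_j = s·1` is (3.35)∧(3.36)-regular at
every size `c₃₅α₀ ≥ |s|` (any `κ`, `r ≥ 0`) — the window of `ne2PlusUnit_kingE` below is inhabited by non-zero backgrounds. [folklore] -/
theorem kingBg_reg_diagonal (κ : ℝ) {r : ℝ} (hr : 0 ≤ r) (K : Fin (d + 1) → ℕ) [∀ μ, NeZero (K μ)] {s c35 α₀ : ℝ}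
    (hs : |s| ≤ c35 * α₀) :
    (kingBg κ r K).Reg335 c35 α₀ (fun _ => s • (1 : Matrix (Tor K) (Tor K) ℝ)) ∧
      (kingBg κ r K).Reg336 c35 α₀ (fun _ => s • (1 : Matrix (Tor K) (Tor K) ℝ)) := by
  have hc : 0 ≤ c35 * α₀ := (abs_nonneg s).trans hs
  refine ⟨fun j z w => ?_, fun j z w => ?_⟩
  · show |(s • (1 : Matrix (Tor K) (Tor K) ℝ)) z w| ≤ c35 * α₀ * Real.exp (-(2 * κ * tdistT K z w))
    by_cases h : z = w
    · subst h
      rw [Matrix.smul_apply, Matrix.one_apply_eq, smul_eq_mul, mul_one, (tdistT_isPseudoDist K).zero, mul_zero, neg_zero, Real.exp_zero, mul_one]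
      exact hs
    · rw [Matrix.smul_apply, Matrix.one_apply_ne h, smul_zero, abs_zero]
      positivity
  · show |((s • (1 : Matrix (Tor K) (Tor K) ℝ)) - s • (1 : Matrix (Tor K) (Tor K) ℝ)) z w| ≤ c35 * α₀ * r ^ j
    rw [sub_self, Matrix.zero_apply, abs_zero]
    positivity

/-- The background sort at an index of the King family: rate `κ′ = kapCT`, ratio `L⁻²`. [folklore] -/
@[reducible] def kingBgK (a : ℝ) (i : KingIndex d L) : B9.Backgrounds :=
  kingBg (kapCT (d + 1) a L) (((L : ℝ) ^ 2)⁻¹) (kingTor i)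

/-- THE η-PAIRING of the two King geometries with the background sort live: as part 1's `kingPairing` (identity on sites and arguments), the
background transport `avg` the IDENTITY (both runs' unit-lattice towers live on the same unit lattice). [cite: King1986, p.664 (convention before Prop. 3.8)] -/
def kingPairingE (a : ℝ) (i : KingIndex d L) : EtaPairing (kingGeoC i) (kingGeoF i) (kingBgK a i) (kingBgK a i) where
  n := i.n
  k_eq := rfl
  L_eq := rfl
  M_eq := rfl
  eta_eq := (kingPairing i).eta_eq
  ι := fun y => y
  scale_ι := fun _ => rfl
  dist_ι := fun _ _ => rfl
  τ := fun lam => lam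
  suppIn_τ := fun _ _ h => h
  supNorm_τ := fun _ => le_rfl
  avg := fun E => E
  avg_one := rfl

/-- THE DRESSED KING FAMILY OF PAIRED INSTANCES: part 1's realised geometries, the background sort `kingBgK` LIVE on both sides, identity pairing.
[cite: Balaban1985BackgroundPropagators, Thm 3.14 pp.426–427 (typing template)] -/
def kingInstanceE (a : ℝ) (i : KingIndex d L) : PairedInstance :=
  ⟨kingGeoC i, kingGeoF i, kingBgK a i, kingBgK a i, kingPairingE a i⟩

/-! ## §2 The dressed tower and its covariance; thresholds and constants -/

section Dressed

variable {dd : ℕ} (a m2 : ℝ) (L : ℕ) [NeZero L] (M : Fin dd → ℕ) [∀ μ, NeZero (M μ)]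

/-- **THE DRESSED UNIT-LATTICE COVARIANCE** `C_E^{(j)} := (Δ^{(max j 1)} + E_j + aL⁻²Q*Q)⁻¹` of the tower `Δ + E` at the background `E`.
[cite: King1986, (4.32) p.674 (the undressed object, A = 0)] -/
def kingCovE (E : ℕ → Matrix (Tor (fine L M)) (Tor (fine L M)) ℝ) (j : ℕ) : Matrix (Tor (fine L M)) (Tor (fine L M)) ℝ :=
  (kingTower a m2 L M j + E j + kingBlock a L M)⁻¹

variable {a m2 L M}

/-- At the trivial background the dressed covariance is the undressed one. [folklore] -/
theorem kingCovE_zero (j : ℕ) : kingCovE a m2 L M 0 j = (kingTower a m2 L M j + kingBlock a L M)⁻¹ := by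
  simp only [kingCovE, Pi.zero_apply, add_zero]

end Dressed

/-- THE PERTURBATION-SIZE THRESHOLD `c̄ = γ₀∕(8V)`: sizes `c₃₅α₀ ≤ c̄` keep the Combes–Thomas gap (`ρ + ρ_B ≤ γ₀∕2`, `2c̄V = γ₀∕4`). [folklore] -/
def kingCbar (dd : ℕ) (a : ℝ) (L : ℕ) : ℝ := gam0L dd a L / (8 * V45 dd a L)

/-- THE LIPSCHITZ CONSTANT `Λ_K = (4∕γ₀)²·V²` of the background dependence. [folklore] -/
def kingLip (dd : ℕ) (a : ℝ) (L : ℕ) : ℝ := (4 / gam0L dd a L) ^ 2 * V45 dd a L ^ 2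

/-- THE DRESSED TOWER CONSTANT `C_K^E = √((θ̄a + c̄)·2(C_U + c̄))·(4∕γ₀)²·V²`. [folklore] -/
def kingCE (dd : ℕ) (a : ℝ) (L : ℕ) : ℝ :=
  Real.sqrt ((thetaBar a L * a + kingCbar dd a L) * (2 * (CDelU dd a (aminL a L) + kingCbar dd a L))) * kingLip dd a L

section Constants

variable {dd : ℕ} {a : ℝ} {L : ℕ}

/-- `c̄ > 0`. [folklore] -/
theorem kingCbar_pos (ha : 0 < a) (hL : 2 ≤ L) : 0 < kingCbar dd a L := by
  unfold kingCbar
  have := gam0L_pos (d := dd) ha hL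
  have := V45_pos dd ha hL
  positivity

/-- `c̄·V = γ₀∕8`. [folklore] -/
theorem kingCbar_mul_V45 (ha : 0 < a) (hL : 2 ≤ L) : kingCbar dd a L * V45 dd a L = gam0L dd a L / 8 := by
  unfold kingCbar
  have hV := (V45_pos dd ha hL).ne'
  field_simp

/-- THE GAP SURVIVES EVERY PERTURBATION OF SIZE `≤ c̄`: `ρ + ρ_B + 2c_E V < γ₀` for `0 ≤ c_E ≤ c̄`. [folklore] -/
theorem kingGap (ha : 0 < a) (hL : 2 ≤ L) {cE : ℝ} (hcE : cE ≤ kingCbar dd a L) :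
    kingRho dd a L + kingRhoB dd a L + 2 * (cE * V45 dd a L) < gam0L dd a L := by
  have h1 := kingRho_add_le (dd := dd) ha hL
  have h2 := kingCbar_mul_V45 (dd := dd) ha hL
  have h3 := gam0L_pos (d := dd) ha hL
  have h4 : cE * V45 dd a L ≤ kingCbar dd a L * V45 dd a L := mul_le_mul_of_nonneg_right hcE (V45_pos dd ha hL).le
  linarith

/-- The margin left by a perturbation of size `≤ c̄` is at least `γ₀∕4`. [folklore] -/
theorem kingMargin (ha : 0 < a) (hL : 2 ≤ L) {cE : ℝ} (hcE : cE ≤ kingCbar dd a L) :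
    gam0L dd a L / 4 ≤ (gam0L dd a L - cE * V45 dd a L) - ((kingRho dd a L + cE * V45 dd a L) + kingRhoB dd a L) := by
  have h1 := kingRho_add_le (dd := dd) ha hL
  have h2 := kingCbar_mul_V45 (dd := dd) ha hL
  have h4 : cE * V45 dd a L ≤ kingCbar dd a L * V45 dd a L := mul_le_mul_of_nonneg_right hcE (V45_pos dd ha hL).le
  linarith

/-- The squared inverse margin is at most `(4∕γ₀)²`, so the cE-dependent constants are dominated by `Λ_K`. [folklore] -/
theorem inv_margin_sq_le (ha : 0 < a) (hL : 2 ≤ L) {cE : ℝ} (hcE : cE ≤ kingCbar dd a L) :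
    (((gam0L dd a L - cE * V45 dd a L) - ((kingRho dd a L + cE * V45 dd a L) + kingRhoB dd a L))⁻¹) ^ 2 * V45 dd a L ^ 2
      ≤ kingLip dd a L := by
  have hγ := gam0L_pos (d := dd) ha hL
  have hm := kingMargin (dd := dd) ha hL hcE
  have hq : 0 < gam0L dd a L / 4 := by positivity
  have hinv : ((gam0L dd a L - cE * V45 dd a L) - ((kingRho dd a L + cE * V45 dd a L) + kingRhoB dd a L))⁻¹ ≤ 4 / gam0L dd a L := by
    rw [show (4 : ℝ) / gam0L dd a L = (gam0L dd a L / 4)⁻¹ by rw [inv_div]]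
    exact inv_anti₀ hq hm
  have hinv0 : 0 ≤ ((gam0L dd a L - cE * V45 dd a L) - ((kingRho dd a L + cE * V45 dd a L) + kingRhoB dd a L))⁻¹ :=
    inv_nonneg.mpr (hq.le.trans hm)
  unfold kingLip
  gcongr

/-- `Λ_K > 0`, `C_K^E > 0`. [folklore] -/
theorem kingCE_pos (ha : 0 < a) (hL : 2 ≤ L) : 0 < kingLip dd a L ∧ 0 < kingCE dd a L := by
  have hγ := gam0L_pos (d := dd) ha hL
  have hV := V45_pos dd ha hL
  have hc := kingCbar_pos (dd := dd) ha hL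
  have hθ := thetaBar_mul_nonneg (a := a) ha hL
  have hC := CDelU_pos (d := dd) ha (aminL_pos ha hL)
  have hLip : 0 < kingLip dd a L := by unfold kingLip; positivity
  have : 0 < Real.sqrt ((thetaBar a L * a + kingCbar dd a L) * (2 * (CDelU dd a (aminL a L) + kingCbar dd a L))) :=
    Real.sqrt_pos.mpr (by positivity)
  exact ⟨hLip, by unfold kingCE; positivity⟩

end Constants

/-! ## §3 The five leaves of the dressed tower, uniformly over the regular backgrounds; the root; background-Lipschitz -/

section DressedLeaves

variable {dd : ℕ} {a m2 : ℝ} {L : ℕ} [NeZero L] {M : Fin dd → ℕ} [∀ μ, NeZero (M μ)]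

/-- **THE FIVE LEAVES OF THE DRESSED KING TOWER `Δ + E`** at a background `E` that is k-uniformly local at rate `κ′` with size `c_E` and has a geometric
one-step sup rate `ε_E·(L⁻²)^j`: constants `(γ₀ − c_E V, κ′, ρ + c_E V, ρ_B, C_U + c_E, θ̄a + ε_E, L⁻², V)` (part 3's leaves + `perturbedLeaves`).
[cite: King1986, (4.33)–(4.34) p.674, Lemma 4.3 (4.18) p.672, (4.41) p.675 (the undressed leaves, A = 0)] -/
theorem kingLeavesE (ha : 0 < a) (hm : 0 < m2) (hL : 2 ≤ L) {E : ℕ → Matrix (Tor (fine L M)) (Tor (fine L M)) ℝ} {cE εE : ℝ}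
    (hcE : 0 ≤ cE) (h335 : UniformKernelDecay E (tdistT (fine L M)) cE (kapCT dd a L))
    (h336 : EffectiveOperatorSupRate E εE (((L : ℝ) ^ 2)⁻¹)) :
    UniformCoercive (kingTower a m2 L M + E) (kingBlock a L M) (gam0L dd a L - cE * V45 dd a L) ∧
      UniformCTBound (kingTower a m2 L M + E) (kingBlock a L M) (tdistT (fine L M)) (kapCT dd a L) (kingRho dd a L + cE * V45 dd a L)
        (kingRhoB dd a L) ∧
      UniformKernelDecay (kingTower a m2 L M + E) (tdistT (fine L M)) (CDelU dd a (aminL a L) + cE) (kapCT dd a L) ∧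
      EffectiveOperatorSupRate (kingTower a m2 L M + E) (thetaBar a L * a + εE) (((L : ℝ) ^ 2)⁻¹) ∧
      VolumeSum (tdistT (fine L M)) (kapCT dd a L) (V45 dd a L) :=
  perturbedLeaves (isPseudoMetric_tdistT (fine L M)) (kapCT_pos_le (d := dd) ha hL).1.le hcE (uniformCoercive_kingTower ha hm hL)
    (uniformCTBound_kingTower ha hm hL) (uniformKernelDecay_kingTower ha hm hL) (effectiveOperatorSupRate_kingTower ha hm hL)
    (volumeSum_kingTorus ha hL) h335 h336

/-- **THE ROOT FOR THE DRESSED TOWER — (4.38) WITH THE BACKGROUND LIVE**: for a background of size `c_E ≤ c̄` with one-step rate `ε_E ≤ c̄`, at every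
level and all sites `|C_E^{(j)}(x, y) − C_E^{(j+1)}(x, y)| ≤ C_K^E·(L⁻¹)^j·e^{−δ₄₅|x−y|_T}` — SAME decay `δ₄₅` and SAME rate `L⁻¹` as the undressed
`covarianceTowerRate_kingTower`, constant `C_K^E` uniform over the regular backgrounds. [cite: King1986, Lemma 4.5 (4.38) p.674 (A = 0 template)] -/
theorem covarianceTowerRate_kingTowerE (ha : 0 < a) (hm : 0 < m2) (hL : 2 ≤ L) {E : ℕ → Matrix (Tor (fine L M)) (Tor (fine L M)) ℝ}
    {cE εE : ℝ} (hcE0 : 0 ≤ cE) (hcE : cE ≤ kingCbar dd a L) (hεE0 : 0 ≤ εE) (hεE : εE ≤ kingCbar dd a L)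
    (h335 : UniformKernelDecay E (tdistT (fine L M)) cE (kapCT dd a L)) (h336 : EffectiveOperatorSupRate E εE (((L : ℝ) ^ 2)⁻¹)) :
    CovarianceTowerRate (kingTower a m2 L M + E) (kingBlock a L M) (tdistT (fine L M)) (kingCE dd a L) (delta45 dd a L) ((L : ℝ)⁻¹) := by
  have hθ := thetaBar_mul_nonneg (a := a) ha hL
  have h := covarianceTowerRate_add_of_leaves (isPseudoMetric_tdistT (fine L M)) (kapCT_pos_le (d := dd) ha hL).1.le hcE0 hθ hεE0
    (by positivity) (kingGap (dd := dd) ha hL hcE) (uniformCoercive_kingTower ha hm hL) (uniformCTBound_kingTower ha hm hL)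
    (uniformKernelDecay_kingTower ha hm hL) (effectiveOperatorSupRate_kingTower ha hm hL) (volumeSum_kingTorus ha hL) h335 h336
  have hsq : Real.sqrt (((L : ℝ) ^ 2)⁻¹) = (L : ℝ)⁻¹ := by rw [Real.sqrt_inv, Real.sqrt_sq (by positivity)]
  have hC := CDelU_pos (d := dd) ha (aminL_pos ha hL)
  have hcb := (kingCbar_pos (dd := dd) ha hL).le
  have hconst : Real.sqrt ((thetaBar a L * a + εE) * (2 * (CDelU dd a (aminL a L) + cE)))
      * (((gam0L dd a L - cE * V45 dd a L) - ((kingRho dd a L + cE * V45 dd a L) + kingRhoB dd a L))⁻¹) ^ 2 * V45 dd a L ^ 2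
        ≤ kingCE dd a L := by
    unfold kingCE
    rw [mul_assoc]
    refine mul_le_mul (Real.sqrt_le_sqrt (by gcongr)) (inv_margin_sq_le (dd := dd) ha hL hcE) (by positivity) (Real.sqrt_nonneg _)
  intro k x y
  have hk := h k x y
  rw [hsq] at hk
  refine hk.trans (mul_le_mul_of_nonneg_right (mul_le_mul_of_nonneg_right hconst (pow_nonneg (by positivity) k)) (Real.exp_pos _).le)

/-- **BACKGROUND-LIPSCHITZ IN POSITION SPACE, UNIFORMLY IN THE LEVEL** (King's (4.39)–(4.41) at one level, `King1986.lemma45` through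
`inv_sub_inv_perturbed_le`): for a background local at rate `κ′` with size `c_E ≤ c̄`, at EVERY level `j` and all sites
`|(Δ^{(max j 1)} + aL⁻²Q*Q)⁻¹(x, y) − C_E^{(j)}(x, y)| ≤ c_E·Λ_K·e^{−δ₄₅|x−y|_T}` — LINEAR in the background's size, with decay (only the locality letter is
used). [cite: King1986, (4.39)–(4.41) p.675 (the mechanism, A = 0)] -/
theorem kingCovE_lipschitz (ha : 0 < a) (hm : 0 < m2) (hL : 2 ≤ L) {E : ℕ → Matrix (Tor (fine L M)) (Tor (fine L M)) ℝ} {cE : ℝ}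
    (hcE0 : 0 ≤ cE) (hcE : cE ≤ kingCbar dd a L) (h335 : UniformKernelDecay E (tdistT (fine L M)) cE (kapCT dd a L)) (j : ℕ)
    (x y : Tor (fine L M)) :
    |(kingTower a m2 L M j + kingBlock a L M)⁻¹ x y - kingCovE a m2 L M E j x y|
      ≤ cE * kingLip dd a L * Real.exp (-(delta45 dd a L * tdistT (fine L M) x y)) := by
  have h := inv_sub_inv_perturbed_le (isPseudoMetric_tdistT (fine L M)) (kapCT_pos_le (d := dd) ha hL).1.le hcE0
    (kingGap (dd := dd) ha hL hcE) (uniformCoercive_kingTower ha hm hL) (uniformCTBound_kingTower ha hm hL) (volumeSum_kingTorus ha hL) h335 j x y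
  refine h.trans ?_
  show _ ≤ cE * kingLip dd a L * Real.exp (-(kapCT dd a L / 2 * tdistT (fine L M) x y))
  rw [mul_assoc cE]
  exact mul_le_mul_of_nonneg_right (mul_le_mul_of_nonneg_left (inv_margin_sq_le (dd := dd) ha hL hcE) hcE0) (Real.exp_pos _).le

end DressedLeaves

/-! ## §4 The socket fires with the background block LIVE: `NE2PlusUnit` by name, (3.35) ∧ (3.36) CONSUMED -/

section Socket

variable {a m2 : ℝ}

/-- THE DRESSED UNIT KERNEL of the King family: at index `i` and background `E`, `(y, y′) ↦ C_E^{(k+1)}(y, y′) − C_E^{(k)}(y, y′)` — GENUINELY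
configuration-dependent (the one-step η-difference of the dressed covariances). [cite: King1986, Lemma 4.5 (4.38) p.674 (the differenced object, A = 0); Balaban1985BackgroundPropagators, Thm 3.15 (3.187) p.432 (C^{(k)}(Λ;U): shape)] -/
def kingKerE (a m2 : ℝ) (i : KingIndex d L) : B9.SiteKernel (kingInstanceE a i).gc (kingInstanceE a i).Bf :=
  ⟨fun E y y' => kingCovE a m2 L i.Mn E (i.k + 1) y y' - kingCovE a m2 L i.Mn E i.k y y'⟩

/-- `unitDist :=` King's periodic unit-lattice distance, on the dressed family. [cite: King1986, Lemma 4.5 (4.38) p.674] -/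
def kingDistE (a : ℝ) : ∀ i : KingIndex d L, (kingInstanceE a i).gc.Site → (kingInstanceE a i).gc.Site → ℝ :=
  fun i y y' => tdistT (kingTor i) y y'

/-- At the trivial background the dressed kernel IS part 3's one-step King kernel `kingKer1` (consistency of the two families). [folklore] -/
theorem kingKerE_zero (i : KingIndex d L) (y y' : Tor (kingTor i)) :
    (kingKerE a m2 i).ker (kingInstanceE a i).Bf.one y y' = (kingKer1 a m2 i).ker () y y' := by
  show kingCovE a m2 L i.Mn 0 (i.k + 1) y y' - kingCovE a m2 L i.Mn 0 i.k y y'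
    = kingCov L i.Mn a m2 (L ^ (i.k + 1)) (i.k + 1) y y' - kingCov L i.Mn a m2 (L ^ i.k) i.k y y'
  rw [kingCovE_zero, kingCovE_zero, kingCov_eq_towerInv i.Mn (by omega : 1 ≤ i.k + 1), kingCov_eq_towerInv i.Mn i.one_le_k]

/-- **THE SOCKET FIRES WITH THE BACKGROUND BLOCK LIVE — `NE2PlusUnit` BY NAME, (3.35) ∧ (3.36) CONSUMED, all five leaves LIVE at every regular
background** (torus dimension `d + 1`, `L ≥ 2`, `a, m² > 0`, every `c₃₅ > 0`): on the dressed family `kingInstanceE a` (index = torus, `k ≥ 1`, shift,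
direction, free size parameter `Msz ≥ 1`; backgrounds = perturbation towers) with the dressed one-step unit kernel `kingKerE`, `inΛ := ⊤`,
`unitDist := tdistT`: the socket's window is `a₀ := c̄∕c₃₅` (so `Msz·α₀ ≤ a₀ ⇒ c₃₅α₀ ≤ c̄`), (3.35) supplies the locality letter and (3.36) the two-spacing
letter of the background at size `c₃₅α₀ ≤ c̄`, `ne2PlusUnit_of_freeLeaves_add` (part 6a) fires on part 3's free leaves; constants
`(δ₀, a₀, B₀, θ) = (δ₄₅, c̄∕c₃₅, √(2(θ̄a + c̄)(C_U + c̄))·(γ₀ − ρ − ρ_B − γ₀∕4)⁻²·V², L⁻¹)` uniform in the index AND the background.  HONEST SCOPE: King's `A = 0` scalar tower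
dressed by an ABSTRACT local perturbation tower; the regularity letters are READ as locality ∕ two-spacing bounds of the perturbation (for Bałaban's
`Δ^{(k)}(U) − Δ^{(k)}(1)` NOT PRINTED); NOT Bałaban's `C^{(k)}(Λ; U)`; count-neutral. [cite: King1986, Lemma 4.5 (4.38) p.674 with (4.33)–(4.34), Lemma 4.3 (4.18) p.672, (4.41) p.675; Balaban1985BackgroundPropagators, Thm 3.15 (3.187) p.432 (quantifier template)] -/
theorem ne2PlusUnit_kingE (ha : 0 < a) (hm : 0 < m2) (hL : 2 ≤ L) {c35 : ℝ} (hc : 0 < c35) :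
    NE2PlusUnit c35 (kingInstanceE (d := d) (L := L) a) (kingKerE a m2) (fun _ _ => True) (kingDistE a) := by
  have hamin := aminL_pos ha hL
  have hLr : (1 : ℝ) < L := by exact_mod_cast hL
  have hθ := thetaBar_mul_nonneg (a := a) ha hL
  have hcb := kingCbar_pos (dd := d + 1) ha hL
  have hr0 : 0 < ((L : ℝ) ^ 2)⁻¹ := by positivity
  have hr1 : ((L : ℝ) ^ 2)⁻¹ < 1 := inv_lt_one_of_one_lt₀ (by nlinarith)
  refine ne2PlusUnit_of_freeLeaves_add (c35 := c35) (pi := kingInstanceE (d := d) (L := L) a) (Kd := kingKerE a m2)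
    (inΛ := fun _ _ => True) (unitDist := kingDistE a) (m := fun i => Tor (kingTor i)) (a₀ := kingCbar (d + 1) a L / c35)
    (div_pos hcb hc) (fun _ y => y) (fun i => tdistT (kingTor i)) (fun i => kingTower a m2 L i.Mn) (fun _ E => E)
    (fun i => kingBlock a L i.Mn) (cE := kingCbar (d + 1) a L) (εE := kingCbar (d + 1) a L)
    (kingGap (dd := d + 1) ha hL le_rfl) (kapCT_pos_le (d := d + 1) ha hL).1 (by positivity)
    (by have := CDelU_pos (d := d + 1) ha hamin; positivity) hcb.le (V45_pos (d + 1) ha hL) hr0 hr1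
    (fun i => isPseudoMetric_tdistT (kingTor i)) (fun _ _ _ => le_rfl)
    (fun i => ⟨uniformCoercive_kingTower ha hm hL, uniformCTBound_kingTower ha hm hL, uniformKernelDecay_kingTower ha hm hL,
      effectiveOperatorSupRate_kingTower ha hm hL, volumeSum_kingTorus ha hL⟩)
    fun i α₀ hα hMa E h335 h336 => ?_
  have hα : c35 * α₀ ≤ kingCbar (d + 1) a L := by
    have h1 : α₀ ≤ i.Msz * α₀ := le_mul_of_one_le_left hα.le i.one_le_Msz
    have h2 : α₀ ≤ kingCbar (d + 1) a L / c35 := h1.trans hMa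
    rwa [le_div_iff₀ hc, mul_comm] at h2
  exact ⟨uniformKernelDecay_mono h335 hα, effectiveOperatorSupRate_mono hr0.le h336 hα, fun y y' => rfl⟩

/-- … and the trivial-background unit layer `NE2ZeroUnit` of the dressed family (the zero tower is regular at every size). [cite: King1986, Lemma 4.5 (4.38) p.674] -/
theorem ne2ZeroUnit_kingE (ha : 0 < a) (hm : 0 < m2) (hL : 2 ≤ L) :
    NE2ZeroUnit (kingInstanceE (d := d) (L := L) a) (kingKerE a m2) (fun _ _ => True) (kingDistE a) := by
  refine ne2ZeroUnit_of_ne2PlusUnit (c35 := 1) (fun i => lt_of_lt_of_le one_pos i.one_le_Msz) (fun i α₀ hα => ?_) (fun i α₀ hα => ?_)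
    (ne2PlusUnit_kingE ha hm hL one_pos)
  · intro k z w
    show |(0 : Matrix _ _ ℝ) z w| ≤ _
    rw [Matrix.zero_apply, abs_zero]
    exact mul_nonneg (by linarith) (Real.exp_pos _).le
  · intro k z w
    show |((0 : Matrix _ _ ℝ) - 0) z w| ≤ _
    rw [sub_zero, Matrix.zero_apply, abs_zero]
    exact mul_nonneg (by linarith) (pow_nonneg (by positivity) k)

end Socket

end Summit.QuantumFields.YangMills.BalabanUVNodes.N15.KingModel

end
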